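import Summits.HodgeConjecture.CorCM.GaloisQuaternionCyclicPrimeOddOrder
import Summits.HodgeConjecture.CorCM.GaloisAllTypesEngine
import Summits.HodgeConjecture.CorCM.GaloisDicyclicNondegenerate
import HarnessLib

/-!
# Galois CM fields with group `Q₈ × C_p`: EVERY abelian variety with complex multiplication by the field is stably
# nondegenerate as soon as the primitive types are nondegenerate (e.g. `ord_p 2` odd) — all types, all powers

COR-CM (cell `pub-hodgecm2`), binder seat b04 (gen 29), count-neutral claim QUATERNION-CYCLIC-PRIME, part III♯ — the ALL-TYPES
upgrade of parts II/III (`CorCM/GaloisQuaternionCyclicPrimeNondegenerate`, `…OddOrder`: every PRIMITIVE CM type nondegenerate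
for `ord_p 2` odd) through gen 21's ENGINE `CorCM/GaloisAllTypesEngine`.  KERNEL ONLY: theorems; no definition, no named fact, no
`sorry`.  `HC_CM` is neither used nor claimed.

GROUP THEORY.  In `G₀ = Q₈ × C_p` (`p` an odd prime, complex conjugation `c₀ = (a 2, 1)`) every `v ≠ 1` whose cyclic group avoids
`c₀` is `(1, u)` with `u ≠ 1` (§1 `fst_eq_one_of_not_mem_zpowers`: in `Q₈` every `g ≠ 1` has `g = a 2` or `g² = a 2`, so
`v^p` or `v^{2p}` is `c₀`); then `⟨v⟩ = 1 × C_p = ker(pr₁)` is normal with quotient `Q₈` (§1), the fixed field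
`K₀ = K^{⟨v⟩}` is a Galois CM field with group `Q₈`, and EVERY CM type of a `Q₈`-field is nondegenerate (gen 20
`GaloisDicyclic.isNondegenerate_quaternion`).  The engine (`isStablyNondegenerate_of_forall_admissible'`) then gives:

* **`isStablyNondegenerate_of_ringHom_quaternion_cyclic_of_forall`**: if every PRIMITIVE CM type of `K` is nondegenerate, every
  complex abelian variety `X` with `K ↪ End⁰(X)`, `[K:ℚ] = 2 dim X` (dimension `4p`), is STABLY NONDEGENERATE;
* **`isStablyNondegenerate_of_ringHom_of_odd_orderOf_two`** (`ord_p 2` odd, UNCONDITIONAL), `hodgeConjectureFor_of_isIsogenous_powSucc_…`,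
  `isStablyNondegenerate_of_isCMTypeRealisation_…`, **`hodgeConjectureFor_pow_of_odd_orderOf_two`** — THE HODGE CONJECTURE FOR EVERY
  POWER OF EVERY ABELIAN VARIETY (any CM type, simple or not) WITH CM BY A GALOIS CM FIELD WITH GROUP `Q₈ × C_p`, `ord_p 2` ODD
  (`p = 7, 23, 31, 47, 71, 73, 79, 89, …`).
The hypothesis «every primitive type nondegenerate» is also exactly part V's «no `μ₄`-norm pair» (`…NormPairIff`), so the same
conclusions hold under that combinatorial hypothesis.

## References

* [Shimura1998] G. Shimura, *Abelian Varieties with Complex Multiplication and Modular Functions*, §5.1 Prop. 3, §8.2 Prop. 26.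
* [Gordon1999HodgeAVSurvey] B. B. Gordon, *A survey of the Hodge conjecture for abelian varieties*, Thm. 6.3–6.4, Def. 7.6.
* [Kubota1965] T. Kubota, *On the field extension by complex multiplication*, Trans. AMS 118 (1965), §2, §4 Lemma 2.
-/

noncomputable section

open CategoryTheory CategoryTheory.Limits NumberField

namespace Summit.HodgeConjecture.CorCM.GaloisQuaternionCyclic

open Literature.NumberTheory.ComplexMultiplication
open Literature.AlgebraicGeometry Literature.AlgebraicGeometry.Motives Literature.AlgebraicGeometry.HodgeTheory
open Literature.AlgebraicGeometry.Motives.AbelianVariety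
open Literature.AlgebraicGeometry.ComplexMultiplication
open Literature.AlgebraicGeometry.Pohlmann1968
open Summit.HodgeConjecture.CorCM.GaloisRank
open QuaternionGroup

/-! ## §1 Group theory of `Q₈ × C_p`: the admissible stabilisers are `(1, u)` -/

section Group

variable {p : ℕ} [Fact p.Prime]

/-- In `Q₈` every `g ≠ 1` is `a 2` or squares to `a 2`. [folklore] -/
theorem quaternion_eq_or_sq_eq : ∀ g : QuaternionGroup 2, g ≠ 1 → (g = a 2 ∨ g * g = a 2) := by decide

/-- **An element of `Q₈ × C_p` whose cyclic group avoids `c₀ = (a 2, 1)` has trivial `Q₈`-component.** [folklore] -/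
theorem fst_eq_one_of_not_mem_zpowers (hp2 : p ≠ 2) (v : QuaternionGroup 2 × Multiplicative (ZMod p))
    (hcv : ((a 2, 1) : QuaternionGroup 2 × Multiplicative (ZMod p)) ∉ Subgroup.zpowers v) : v.1 = 1 := by
  have hp : p.Prime := Fact.out
  haveI : NeZero p := ⟨hp.ne_zero⟩
  by_contra h
  have hup : v.2 ^ p = 1 := by
    rw [← ofAdd_toAdd v.2, ← ofAdd_nsmul, nsmul_eq_mul, ZMod.natCast_self, zero_mul]; rfl
  have ha22 : (a 2 : QuaternionGroup 2) * a 2 = 1 := by decide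
  have hodd : Odd p := hp.odd_of_ne_two hp2
  have ha2p : (a 2 : QuaternionGroup 2) ^ p = a 2 := by
    obtain ⟨m, hm⟩ := hodd
    rw [hm, pow_succ, pow_mul, pow_two, ha22, one_pow, one_mul]
  apply hcv
  rcases quaternion_eq_or_sq_eq v.1 h with h1 | h1
  · refine ⟨p, ?_⟩
    change v ^ ((p : ℕ) : ℤ) = _
    rw [zpow_natCast, Prod.ext_iff, Prod.pow_fst, Prod.pow_snd, h1, ha2p, hup]
    exact ⟨rfl, rfl⟩
  · refine ⟨(2 * p : ℕ), ?_⟩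
    change v ^ (((2 * p : ℕ)) : ℤ) = _
    have h2 : v.1 ^ (2 * p) = a 2 := by rw [pow_mul, pow_two, h1, ha2p]
    have h3 : v.2 ^ (2 * p) = 1 := by rw [mul_comm, pow_mul, hup, one_pow]
    rw [zpow_natCast, Prod.ext_iff, Prod.pow_fst, Prod.pow_snd, h2, h3]
    exact ⟨rfl, rfl⟩

/-- `⟨(1, u)⟩ = ker(pr₁)` for `u ≠ 1` (`C_p` has prime order). [folklore] -/
theorem zpowers_eq_ker_fst (v : QuaternionGroup 2 × Multiplicative (ZMod p)) (hv1 : v.1 = 1) (hv : v ≠ 1) :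
    Subgroup.zpowers v = (MonoidHom.fst (QuaternionGroup 2) (Multiplicative (ZMod p))).ker := by
  have hp : p.Prime := Fact.out
  haveI : NeZero p := ⟨hp.ne_zero⟩
  have hu : v.2 ≠ 1 := fun h => hv (Prod.ext hv1 h)
  have htop : Subgroup.zpowers v.2 = ⊤ :=
    zpowers_eq_top_of_prime_card (p := p) (by rw [Nat.card_eq_fintype_card, Fintype.card_multiplicative, ZMod.card]) hu
  ext x
  rw [MonoidHom.mem_ker, MonoidHom.coe_fst]
  constructor
  · rintro ⟨k, rfl⟩
    simp [hv1]
  · intro hx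
    have hx2 : x.2 ∈ Subgroup.zpowers v.2 := by rw [htop]; exact Subgroup.mem_top _
    obtain ⟨k, hk⟩ := hx2
    refine ⟨k, Prod.ext ?_ ?_⟩
    · simp [hv1, hx]
    · simpa using hk

/-- `orderOf (1, u) = p` for `u ≠ 1`. [folklore] -/
theorem orderOf_eq_of_fst_eq_one (v : QuaternionGroup 2 × Multiplicative (ZMod p)) (hv1 : v.1 = 1) (hv : v ≠ 1) :
    orderOf v = p := by
  have hp : p.Prime := Fact.out
  haveI : NeZero p := ⟨hp.ne_zero⟩
  have hu : v.2 ≠ 1 := fun h => hv (Prod.ext hv1 h)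
  have hup : v.2 ^ p = 1 := by
    rw [← ofAdd_toAdd v.2, ← ofAdd_nsmul, nsmul_eq_mul, ZMod.natCast_self, zero_mul]; rfl
  obtain ⟨g, u⟩ := v
  simp only at hv1 hu hup
  subst hv1
  rw [Prod.orderOf_mk, orderOf_one, Nat.lcm_one_left, orderOf_eq_prime hup hu]

end Group

/-! ## §2 All types -/

section Field

variable {p : ℕ} [Fact p.Prime]
variable {K : Type} [Field K] [NumberField K] [IsCMField K] [IsGalois ℚ K]

/-- **THEOREM (ALL TYPES, conditional form).  `K` Galois CM with `Gal(K/ℚ) ≅ Q₈ × C_p` (`p` an odd prime) such that every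
PRIMITIVE CM type of `K` is nondegenerate.  Then EVERY complex abelian variety `X` with `ψ : K →+* End⁰(X)` and `[K:ℚ] = 2 dim X`
is STABLY NONDEGENERATE.**  The admissible stabilisers are `(1, u)`, their fixed fields are `Q₈`-fields, all of whose CM types are
nondegenerate. [cite: Shimura1998, §5.1 Prop. 3, §8.2 Prop. 26] [cite: Gordon1999HodgeAVSurvey, Thm. 6.4 and Def. 7.6]
[cite: Kubota1965, §4 Lemma 2] -/
theorem isStablyNondegenerate_of_ringHom_quaternion_cyclic_of_forall (hp2 : p ≠ 2)
    (e : (K ≃ₐ[ℚ] K) ≃* QuaternionGroup 2 × Multiplicative (ZMod p))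
    (hprim : ∀ (Φ : CMType K) (φ₀ : K →+* ℂ), IsPrimitive (ℂ ≃+* ℂ) Φ.1 φ₀ → IsNondegenerate Φ)
    {X : AbelianVariety ℂ} (ψ : K →+* X.endAlgebra) (hX : Module.finrank ℚ K = 2 * X.dim) :
    IsStablyNondegenerate X := by
  classical
  have hp : p.Prime := Fact.out
  haveI : NeZero p := ⟨hp.ne_zero⟩
  have hc := map_complexConj_eq hp2 e
  refine isStablyNondegenerate_of_forall_admissible' e hc hprim (fun v hv1 hcv Φ₀ => ?_) ψ hX
  have hv := fst_eq_one_of_not_mem_zpowers hp2 v hcv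
  have hker := zpowers_eq_ker_fst v hv hv1
  haveI hN : (Subgroup.zpowers v).Normal := by rw [hker]; exact MonoidHom.normal_ker _
  haveI : IsCMField (IntermediateField.fixedField ((Subgroup.zpowers v).comap
      (e : (K ≃ₐ[ℚ] K) →* QuaternionGroup 2 × Multiplicative (ZMod p)))) :=
    isCMField_fixedField_of_not_mem _ fun h => hcv (hc ▸ Subgroup.mem_comap.1 h)
  haveI : IsGalois ℚ (IntermediateField.fixedField ((Subgroup.zpowers v).comap
      (e : (K ≃ₐ[ℚ] K) →* QuaternionGroup 2 × Multiplicative (ZMod p)))) :=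
    isGalois_fixedField_comap_zpowers e v
  obtain ⟨e₀⟩ := exists_mulEquiv_fixedField_quotient e v
  have e₁ : (QuaternionGroup 2 × Multiplicative (ZMod p)) ⧸ Subgroup.zpowers v ≃* QuaternionGroup 2 :=
    (QuotientGroup.quotientMulEquivOfEq hker).trans
      (QuotientGroup.quotientKerEquivOfSurjective _ Prod.fst_surjective)
  exact GaloisDicyclic.isNondegenerate_quaternion (n := 2) (k := 1) (by norm_num) (e₀.trans e₁) Φ₀

/-- **THEOREM (ALL TYPES, `ord_p 2` odd — UNCONDITIONAL).**  `K` Galois CM with `Gal(K/ℚ) ≅ Q₈ × C_p`, `ord_p 2` odd: every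
complex abelian variety `X` with `K ↪ End⁰(X)`, `[K:ℚ] = 2 dim X` (dimension `4p`) is STABLY NONDEGENERATE.
[cite: Shimura1998, §5.1 Prop. 3, §8.2 Prop. 26] [cite: Gordon1999HodgeAVSurvey, Thm. 6.4 and Def. 7.6] -/
theorem isStablyNondegenerate_of_ringHom_of_odd_orderOf_two (hodd : Odd (orderOf (2 : ZMod p)))
    (e : (K ≃ₐ[ℚ] K) ≃* QuaternionGroup 2 × Multiplicative (ZMod p))
    {X : AbelianVariety ℂ} (ψ : K →+* X.endAlgebra) (hX : Module.finrank ℚ K = 2 * X.dim) :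
    IsStablyNondegenerate X :=
  isStablyNondegenerate_of_ringHom_quaternion_cyclic_of_forall (ne_two_of_odd_orderOf_two hodd) e
    (fun _ φ₀ hprim => isNondegenerate_of_isPrimitive_of_odd_orderOf_two hodd e φ₀ hprim) ψ hX

/-- **The Hodge conjecture for everything isogenous to a power of such an `X`** (`ord_p 2` odd) — no simplicity. UNCONDITIONAL.
[cite: Gordon1999HodgeAVSurvey, Thm. 6.3–6.4] -/
theorem hodgeConjectureFor_of_isIsogenous_powSucc_of_odd_orderOf_two (hodd : Odd (orderOf (2 : ZMod p)))
    (e : (K ≃ₐ[ℚ] K) ≃* QuaternionGroup 2 × Multiplicative (ZMod p))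
    {X : AbelianVariety ℂ} (ψ : K →+* X.endAlgebra) (hX : Module.finrank ℚ K = 2 * X.dim)
    {B : AbelianVariety ℂ} {N : ℕ} (h : IsIsogenous B (X.powSucc N)) : HodgeConjectureFor B.dim B.X :=
  (isStablyNondegenerate_of_ringHom_of_odd_orderOf_two hodd e ψ hX).hodgeConjectureFor_of_isIsogenous_powSucc h

variable {Φ : CMType K} {A : AbelianVariety ℂ} {ι : 𝓞 K →+* End A} {θ : K →+* Module.End ℂ (complexBetti A.X 1)}

/-- **Realisation form**: every abelian variety `(A, ι)` of ANY CM type `(K; Φ)` is stably nondegenerate, `ord_p 2` odd.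
[cite: Shimura1998, §5.1–5.2] [cite: Gordon1999HodgeAVSurvey, Thm. 6.4] -/
theorem isStablyNondegenerate_of_isCMTypeRealisation_of_odd_orderOf_two (hodd : Odd (orderOf (2 : ZMod p)))
    (e : (K ≃ₐ[ℚ] K) ≃* QuaternionGroup 2 × Multiplicative (ZMod p)) (hA : IsCMTypeRealisation Φ A ι θ) :
    IsStablyNondegenerate A := by
  obtain ⟨i, -⟩ := exists_ringHom_endAlgebra ι
  exact isStablyNondegenerate_of_ringHom_of_odd_orderOf_two hodd e i (finrank_eq_two_mul_dim_of_isCMTypeRealisation hA)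

/-- **THE HODGE CONJECTURE FOR EVERY POWER OF EVERY ABELIAN VARIETY (any CM type, simple or not) WITH CM BY A GALOIS CM FIELD
WITH GROUP `Q₈ × C_p`, `ord_p 2` ODD** — part III's `hodgeConjectureFor_pow_of_isSimple_of_odd_orderOf_two` WITHOUT `A.IsSimple`.
UNCONDITIONAL. [cite: Gordon1999HodgeAVSurvey, Thm. 6.4] [cite: Shimura1998, §5.1 Prop. 3 and §8.2 Prop. 26] -/
theorem hodgeConjectureFor_pow_of_odd_orderOf_two (hodd : Odd (orderOf (2 : ZMod p)))
    (e : (K ≃ₐ[ℚ] K) ≃* QuaternionGroup 2 × Multiplicative (ZMod p)) (hA : IsCMTypeRealisation Φ A ι θ) (N : ℕ) :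
    HodgeConjectureFor (⨁ fun _ : Fin N => A).dim (⨁ fun _ : Fin N => A).X :=
  hodgeConjectureFor_of_isDivisorGenerated _
    ((isStablyNondegenerate_iff_forall_isDivisorGenerated_biproduct A).1
      (isStablyNondegenerate_of_isCMTypeRealisation_of_odd_orderOf_two hodd e hA) N)

/-- Instance: `Q₈ × C₇` (`ord₇ 2 = 3`): HC for all powers of EVERY abelian variety with CM by such a field (degree `56`).
[cite: Gordon1999HodgeAVSurvey, Thm. 6.4] -/
theorem hodgeConjectureFor_pow_quaternion_cyclicSeven_allTypes
    (e : (K ≃ₐ[ℚ] K) ≃* QuaternionGroup 2 × Multiplicative (ZMod 7)) {Φ : CMType K} {A : AbelianVariety ℂ}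
    {ι : 𝓞 K →+* End A} {θ : K →+* Module.End ℂ (complexBetti A.X 1)} (hA : IsCMTypeRealisation Φ A ι θ) (N : ℕ) :
    HodgeConjectureFor (⨁ fun _ : Fin N => A).dim (⨁ fun _ : Fin N => A).X :=
  haveI : Fact (Nat.Prime 7) := ⟨by norm_num⟩
  hodgeConjectureFor_pow_of_odd_orderOf_two (by rw [orderOf_two_zmod_seven]; exact ⟨1, rfl⟩) e hA N

end Field

end Summit.HodgeConjecture.CorCM.GaloisQuaternionCyclic

end
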